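import Summits.QuantumFields.YangMills.Theorems.Instrument.BesselCapObjectsKZL2rpLIM
import Summits.QuantumFields.YangMills.Theorems.Instrument.LimitBlocksKZL2rpLIM
import Summits.QuantumFields.GaugeBoot.Certificates.KZL2rpD4LIMCapTab
import Summits.QuantumFields.GaugeBoot.Rows.KZL2rpD4CapWeight
import HarnessLib

/-!
# YM instrument cell — `SU(2)`, `D = 4`: the second-tier («∣ cap») hypotheses of a «LIMIT ∣ cap» certificate replay hold at the class-LIMIT
# variables `yLim μ` — capped difference-Hankel blocks PSD and the weight-form boxes (P-A5 STAGE 3, S3b; END-independent)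

Cell `ym-instrument` (HUMAN RULING D-0084 (2); director-ym R138; HOME `run/shared/lean/pub/ym-instrument/`), crew (a), Lean typist seat
`ym-instrument-boot-lean-1` (gen 4). Planner work order P-A5 STAGE 3 «LIMIT ∣ cap kernel replay» (boot-plan 2026-08-27T14:33:09Z; LEAD A-0826-82);
ladder consequence: provenance of the three R0 «LIMIT ∣ cap» rows of TABLE-A1 (IR `stmt-QuantumFields-19354`; cells «C ∣ cap» → T on the ENDs' bind
tops; no number moves). A «LIMIT ∣ cap» certificate half emitted on the weighted two-tier window route (`Sparse.objective_boundW_of_le`,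
`Certificates/SparseReducedWindowBoundW`) consumes, beyond the 75 first-tier PSD hypotheses of `KZL2rpD4LIM` (discharged at limit points by
`ClassAFeasibleAtLimitKZL2rp.redBlock_posSemidef_yLim` + `LimitBlocksKZL2rpLIM.posSemidef_all_yLim`), exactly two more kinds of hypothesis, BOTH
discharged here at `y := yLim μ`, hypothesis-free, for every infinite-volume limit point along even tori:
(T2) the two SECOND-TIER blocks `Sparse.redE (KZL2rpD4LIMCap.EB p q) t 2 10878 (yLim μ)` — the capped difference-Hankel blocks ×`q` — are PSD
(`capBlocks_posSemidef_yLim_b9o5` with `(p, q) = (2177, 2500)`, `…_b11o5` with `(558, 625)`), from the typed cap objects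
`BesselCapObjectsKZL2rpLIM.capObj_b*_D0cap/D1cap` (a positive multiple `q` of their quadratic forms);
(W) the WEIGHT-FORM BOXES `|yLim μ v| ≤ capWeight p q v / capWeight p q 0` for `v ≠ 0` (`abs_yLim_le_capWeight_b9o5/_b2/_b11o5/_b12o5`), from the typed
boxes `BesselCapObjectsKZL2rpLIM.abs_yLim_le_pow_capWit_b*` and `KZL2rpD4.abs_le_capWeight_div_of_abs_le_pow` (`Rows/KZL2rpD4CapWeight`); and the
positivity `0 < capWeight p q 0` the kernel theorem asks for.

HONEST FRAMING (page 1 of every file of this cell): WHAT IS CERTIFIED HERE, AT WHICH `(G, D, L, β)`: `G = SU(2)` (fundamental, standard Wilson action,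
tree coupling `β/2`), `D = 4`, class LIMIT = infinite-volume limit points of the torus Wilson states along strictly increasing sequences of EVEN tori,
`β_std ∈ {9/5, 11/5}` (boxes also at `2`, `12/5`); positivity / box statements about limits of lattice expectations, restated in the data layout of
the certificate kernel; NOT a finite-torus bound, not an area law, string tension, mass gap or continuum statement; no uniqueness of the limit.
No certificate is replayed in this file.
-/

noncomputable section

namespace Summit.QuantumFields.YangMills.Theorems.Instrument

open MeasureTheory Filter Topology Finset Matrix
open Summit.QuantumFields.GaugeBoot
open Summit.QuantumFields.GaugeBoot.Certificates
open Summit.QuantumFields.GaugeBoot.Certificates.Sparse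
open Literature.MathematicalPhysics.QuantumFieldTheory
open Literature.MathematicalPhysics.QuantumLattice (LGConfig IsInfiniteVolumeLimitAlong)

/-! ## The two second-tier blocks as explicit quadratic forms (parametric in `(p, q)`) -/

section Forms

variable (p q : ℕ) (y : Fin 10878 → ℝ)

/-- Quadratic form of second-tier block `0` (`q · hdcap/R1/D0cap{0..1}`: entries `p y₀ − q y₁, p y₁ − q y₂, p y₂ − q y₅`). [folklore] -/
theorem quadForm_cap0 (x : Fin 2 → ℝ) :
    star x ⬝ᵥ (redE (KZL2rpD4LIMCap.EB p q) 0 2 10878 y *ᵥ x) =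
      x 0 * x 0 * ((p : ℝ) * y 0 - (q : ℝ) * y 1) + x 0 * x 1 * ((p : ℝ) * y 1 - (q : ℝ) * y 2) +
        x 1 * x 0 * ((p : ℝ) * y 1 - (q : ℝ) * y 2) + x 1 * x 1 * ((p : ℝ) * y 2 - (q : ℝ) * y 5) := by
  simp [dotProduct, mulVec, Fin.sum_univ_two, redE_apply, Sparse.ent, entU, KZL2rpD4LIMCap.EB, evalComb_cons, evalComb_nil]
  ring

/-- Quadratic form of second-tier block `1` (`q · hdcap/R1/D1cap{0..1}`: entries `p y₁ − q y₂, p y₂ − q y₅, p y₅ − q y₂₇`). [folklore] -/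
theorem quadForm_cap1 (x : Fin 2 → ℝ) :
    star x ⬝ᵥ (redE (KZL2rpD4LIMCap.EB p q) 1 2 10878 y *ᵥ x) =
      x 0 * x 0 * ((p : ℝ) * y 1 - (q : ℝ) * y 2) + x 0 * x 1 * ((p : ℝ) * y 2 - (q : ℝ) * y 5) +
        x 1 * x 0 * ((p : ℝ) * y 2 - (q : ℝ) * y 5) + x 1 * x 1 * ((p : ℝ) * y 5 - (q : ℝ) * y 27) := by
  simp [dotProduct, mulVec, Fin.sum_univ_two, redE_apply, Sparse.ent, entU, KZL2rpD4LIMCap.EB, evalComb_cons, evalComb_nil]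
  ring

end Forms

variable {Lk : ℕ → ℕ} {μ : Measure (LGConfig 4 (SU 2))}

/-! ## (T2) The second-tier blocks are PSD at `yLim μ` — `β_std = 9/5` (`ρ = 2177/2500`) -/

section B9o5

variable (hmono : StrictMono Lk) (heven : ∀ k, Even (Lk k + 1))
  (hμ : IsInfiniteVolumeLimitAlong (suRep 2) ((9 / 5 : ℝ) / (2 : ℕ)) Lk μ)
include hmono heven hμ

/-- Second-tier block `0` at `9/5` (`2500 · hdcap/R1/D0cap`) is PSD at `yLim μ` (from `capObj_b9o5_D0cap`, ×2500). [folklore] -/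
theorem capBlock0_posSemidef_yLim_b9o5 : (redE (KZL2rpD4LIMCap.EB 2177 2500) 0 2 10878 (yLim μ)).PosSemidef :=
  Matrix.PosSemidef.of_dotProduct_mulVec_nonneg (redE_isHermitian _ _ _ _ _) fun x => by
    rw [quadForm_cap0]
    have h := capObj_b9o5_D0cap hmono heven hμ (x 0) (x 1)
    push_cast
    nlinarith [h]

/-- Second-tier block `1` at `9/5` (`2500 · hdcap/R1/D1cap`) is PSD at `yLim μ` (from `capObj_b9o5_D1cap`, ×2500). [folklore] -/
theorem capBlock1_posSemidef_yLim_b9o5 : (redE (KZL2rpD4LIMCap.EB 2177 2500) 1 2 10878 (yLim μ)).PosSemidef :=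
  Matrix.PosSemidef.of_dotProduct_mulVec_nonneg (redE_isHermitian _ _ _ _ _) fun x => by
    rw [quadForm_cap1]
    have h := capObj_b9o5_D1cap hmono heven hμ (x 0) (x 1)
    push_cast
    nlinarith [h]

/-- **THE TWO SECOND-TIER BLOCKS ARE PSD AT `yLim μ`, `β_std = 9/5`**, in the `redE (KZL2rpD4LIMCap.EB 2177 2500) t (dimL.getD t 0)` form the
certificate modules consume (`hpsd₂` of `Sparse.objective_boundW_of_le`). [folklore] -/
theorem capBlocks_posSemidef_yLim_b9o5 :
    ∀ t : Fin 2, (redE (KZL2rpD4LIMCap.EB 2177 2500) t.val (KZL2rpD4LIMCap.dimL.getD t.val 0) 10878 (yLim μ)).PosSemidef := by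
  intro t
  match t with
  | ⟨0, _⟩ => exact capBlock0_posSemidef_yLim_b9o5 hmono heven hμ
  | ⟨1, _⟩ => exact capBlock1_posSemidef_yLim_b9o5 hmono heven hμ

end B9o5

/-! ## (T2) The second-tier blocks are PSD at `yLim μ` — `β_std = 11/5` (`ρ = 558/625`) -/

section B11o5

variable (hmono : StrictMono Lk) (heven : ∀ k, Even (Lk k + 1))
  (hμ : IsInfiniteVolumeLimitAlong (suRep 2) ((11 / 5 : ℝ) / (2 : ℕ)) Lk μ)
include hmono heven hμ

/-- Second-tier block `0` at `11/5` (`625 · hdcap/R1/D0cap`) is PSD at `yLim μ` (from `capObj_b11o5_D0cap`, ×625). [folklore] -/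
theorem capBlock0_posSemidef_yLim_b11o5 : (redE (KZL2rpD4LIMCap.EB 558 625) 0 2 10878 (yLim μ)).PosSemidef :=
  Matrix.PosSemidef.of_dotProduct_mulVec_nonneg (redE_isHermitian _ _ _ _ _) fun x => by
    rw [quadForm_cap0]
    have h := capObj_b11o5_D0cap hmono heven hμ (x 0) (x 1)
    push_cast
    nlinarith [h]

/-- Second-tier block `1` at `11/5` (`625 · hdcap/R1/D1cap`) is PSD at `yLim μ` (from `capObj_b11o5_D1cap`, ×625). [folklore] -/
theorem capBlock1_posSemidef_yLim_b11o5 : (redE (KZL2rpD4LIMCap.EB 558 625) 1 2 10878 (yLim μ)).PosSemidef :=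
  Matrix.PosSemidef.of_dotProduct_mulVec_nonneg (redE_isHermitian _ _ _ _ _) fun x => by
    rw [quadForm_cap1]
    have h := capObj_b11o5_D1cap hmono heven hμ (x 0) (x 1)
    push_cast
    nlinarith [h]

/-- **THE TWO SECOND-TIER BLOCKS ARE PSD AT `yLim μ`, `β_std = 11/5`**, in the `redE (KZL2rpD4LIMCap.EB 558 625) t (dimL.getD t 0)` form.
[folklore] -/
theorem capBlocks_posSemidef_yLim_b11o5 :
    ∀ t : Fin 2, (redE (KZL2rpD4LIMCap.EB 558 625) t.val (KZL2rpD4LIMCap.dimL.getD t.val 0) 10878 (yLim μ)).PosSemidef := by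
  intro t
  match t with
  | ⟨0, _⟩ => exact capBlock0_posSemidef_yLim_b11o5 hmono heven hμ
  | ⟨1, _⟩ => exact capBlock1_posSemidef_yLim_b11o5 hmono heven hμ

end B11o5

/-! ## (W) The weight-form boxes at limit points -/

/-- **WEIGHT-FORM BOXES at `β_std = 9/5`**: `|yLim μ v| ≤ w_v / w_0` with `w = capWeight 2177 2500` (all `v`; the kernel asks it for `v ≠ 0`).
[folklore] -/
theorem abs_yLim_le_capWeight_b9o5 (hmono : StrictMono Lk)
    (hμ : IsInfiniteVolumeLimitAlong (suRep 2) ((9 / 5 : ℝ) / (2 : ℕ)) Lk μ) (v : Fin 10878) :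
    |yLim μ v| ≤ (KZL2rpD4.capWeight 2177 2500 v.val : ℝ) / (KZL2rpD4.capWeight 2177 2500 0 : ℝ) :=
  KZL2rpD4.abs_le_capWeight_div_of_abs_le_pow 2177 (by norm_num) v
    (by have h := abs_yLim_le_pow_capWit_b9o5 hmono hμ v; push_cast; exact h)

/-- **WEIGHT-FORM BOXES at `β_std = 2`**: `w = capWeight 2207 2500`. [folklore] -/
theorem abs_yLim_le_capWeight_b2 (hmono : StrictMono Lk)
    (hμ : IsInfiniteVolumeLimitAlong (suRep 2) ((2 : ℝ) / (2 : ℕ)) Lk μ) (v : Fin 10878) :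
    |yLim μ v| ≤ (KZL2rpD4.capWeight 2207 2500 v.val : ℝ) / (KZL2rpD4.capWeight 2207 2500 0 : ℝ) :=
  KZL2rpD4.abs_le_capWeight_div_of_abs_le_pow 2207 (by norm_num) v
    (by have h := abs_yLim_le_pow_capWit_b2 hmono hμ v; push_cast; exact h)

/-- **WEIGHT-FORM BOXES at `β_std = 11/5`**: `w = capWeight 558 625`. [folklore] -/
theorem abs_yLim_le_capWeight_b11o5 (hmono : StrictMono Lk)
    (hμ : IsInfiniteVolumeLimitAlong (suRep 2) ((11 / 5 : ℝ) / (2 : ℕ)) Lk μ) (v : Fin 10878) :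
    |yLim μ v| ≤ (KZL2rpD4.capWeight 558 625 v.val : ℝ) / (KZL2rpD4.capWeight 558 625 0 : ℝ) :=
  KZL2rpD4.abs_le_capWeight_div_of_abs_le_pow 558 (by norm_num) v
    (by have h := abs_yLim_le_pow_capWit_b11o5 hmono hμ v; push_cast; exact h)

/-- **WEIGHT-FORM BOXES at `β_std = 12/5`**: `w = capWeight 9013 10000`. [folklore] -/
theorem abs_yLim_le_capWeight_b12o5 (hmono : StrictMono Lk)
    (hμ : IsInfiniteVolumeLimitAlong (suRep 2) ((12 / 5 : ℝ) / (2 : ℕ)) Lk μ) (v : Fin 10878) :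
    |yLim μ v| ≤ (KZL2rpD4.capWeight 9013 10000 v.val : ℝ) / (KZL2rpD4.capWeight 9013 10000 0 : ℝ) :=
  KZL2rpD4.abs_le_capWeight_div_of_abs_le_pow 9013 (by norm_num) v
    (by have h := abs_yLim_le_pow_capWit_b12o5 hmono hμ v; push_cast; exact h)

/-- `0 < w_0` for the four weights of record (`w_0 = q^4`). [folklore] -/
theorem capWeight_zero_pos_of_record :
    0 < KZL2rpD4.capWeight 2177 2500 0 ∧ 0 < KZL2rpD4.capWeight 2207 2500 0 ∧
      0 < KZL2rpD4.capWeight 558 625 0 ∧ 0 < KZL2rpD4.capWeight 9013 10000 0 :=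
  ⟨KZL2rpD4.capWeight_zero_pos _ (by norm_num), KZL2rpD4.capWeight_zero_pos _ (by norm_num),
    KZL2rpD4.capWeight_zero_pos _ (by norm_num), KZL2rpD4.capWeight_zero_pos _ (by norm_num)⟩

end Summit.QuantumFields.YangMills.Theorems.Instrument

end
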